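import Literature.Probability.LatticeModels.DiscreteRectBoundaryTrace
import HarnessLib

/-!
# The offset boundary loop of a discrete topological rectangle winds once around the domain

Topic `Literature/Probability/LatticeModels` (family `crit-ising`); support file for the named fact
`Literature.Probability.LatticeModels.fkIsing_topologicalRectangle_crossingBounds`
(D. Chelkak, H. Duminil-Copin, C. Hongler, *Crossing probabilities in topological rectangles for the
critical planar FK-Ising model*, Electron. J. Probab. 21 (2016), no. 5, Thm. 1.1) and its companions
(`discreteEL_ext_sandwich`, `discreteEL_ext_selfDual`). CDH16 §2.1 take a discrete domain to be a
connected and *simply connected* subgraph of `ℤ²` and use freely that "as `Ω` is simply connected, there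
exists a natural cyclic order on `∂Ω`" and, throughout §4, that paths joining alternate boundary arcs
"topologically must intersect"; the tree presents such a domain (`FKIsingTopologicalRectangleCrossing`:
`DiscreteRect.IsRect E d₀ n`) by ONE orbit of the boundary-tracing map `DiscreteRect.succ` through all
external darts. This file begins the Jordan-curve side of that presentation, with the lattice winding
number `walkWinding` of `Percolation/PlanarDuality.lean` (Kesten 1982, §2.2) as the tool:

* `DiscreteRect.run k p L` — the straight walk of `L` unit steps in direction `e_k` (a `(zdGraph 2).Walk`),
  its vertices (`mem_support_run`) and winding numbers (`walkWinding_run_zero/one/two/three`);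
* `DiscreteRect.opt o d = 8x + o·e_k` — the offset-`o` point of the dart `d = (x, k)` in the eightfold
  refined lattice (a point of the missing edge at distance `o/8` from its base vertex), and
  `DiscreteRect.oconn E o ho d` — **the offset connector** of `d`: the refined-lattice walk from `opt o d`
  to `opt o (succ E d)` at distance `o/8` outside the arrows walked by the trace (round the corner of the
  exterior square in case 1 of `succ`, straight along the edge in case 2, round the concave corner in
  case 3, round three sides of the exterior square in case 4; `2o ≤ 8`);
* `DiscreteRect.oloop E o ho d N` — the concatenation of the connectors of `d, succ d, …, succ^{N-1} d`;
  for `IsRect E d₀ n` and `N = n 0 + n 1 + n 2 + n 3` this is a closed walk, **the offset boundary loop**;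
* `DiscreteRect.walkWinding_oconn` — around the refined point `8z + (½,½)` next to a lattice point `z`, a
  connector piece winds `+1` iff its dart is an east dart on the row of `z` at or right of `z`, `-1` iff
  its successor is a west dart on that row strictly right of `z` (sixteen cases, by `omega`);
* `DiscreteRect.IsRect.walkWinding_oloop_eq_one` — **the offset boundary loop of a presented rectangle
  winds exactly once, counterclockwise, around every vertex of the domain**: by the traversal bijection
  (`IsRect.injOn`, `IsRect.cover`) the total winding is the number of external east darts minus external
  west darts on the row of `z` to its right, which a row scan (`card_filter_east_eq_card_filter_west_add_one`)
  shows to be `1`.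

Not here (next steps of the same programme): the supports of the connectors avoid the refined images of
the edges of `E`, two loops of different offsets are disjoint, and the resulting separation lemma
(walks of `⟨E⟩` joining the arcs `0` and `2` of a rectangle meet walks joining the arcs `1` and `3`).

## References
* D. Chelkak, H. Duminil-Copin, C. Hongler, EJP 21 (2016) no. 5, §2.1 (discrete domains, cyclic order
  on `∂Ω`), §4. [ChelkakDuminilCopinHongler2016]
* H. Kesten, *Percolation theory for mathematicians*, Birkhäuser (1982), §2.2 (winding numbers of
  lattice paths). [KestenPTM1982]
-/

noncomputable section

namespace Literature.Probability.LatticeModels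

namespace DiscreteRect

open SimpleGraph Literature.Probability.Percolation

variable {E : Finset (Sym2 (Site 2))}

/-- `p + e_k` is a lattice neighbour of `p`. [folklore] -/
theorem adj_add_dir (p : Site 2) (k : Fin 4) : (zdGraph 2).Adj p (p + dir k) := by
  apply adj_of_stepKind
  fin_cases k
  · exact .right (by simp [dir]) (by simp [dir])
  · exact .up (by simp [dir]) (by simp [dir])
  · exact .left (by simp [dir]) (by simp [dir])
  · exact .down (by simp [dir]) (by simp [dir])

/-! ### Straight runs -/

/-- **The straight lattice walk of `L` unit steps from `p` in direction `e_k`** (ending at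
`p + L·e_k`, written as an iterate so that the recursion typechecks definitionally). [folklore] -/
def run (k : Fin 4) : (p : Site 2) → (L : ℕ) → (zdGraph 2).Walk p ((fun w : Site 2 ↦ w + dir k)^[L] p)
  | _, 0 => Walk.nil
  | p, L + 1 => Walk.cons (adj_add_dir p k) (run k (p + dir k) L)

/-- The end of a straight run: `p + L·e_k`. [folklore] -/
theorem iterate_add_dir (k : Fin 4) (p : Site 2) (L : ℕ) :
    (fun w : Site 2 ↦ w + dir k)^[L] p = p + (L : ℤ) • dir k := by
  induction L generalizing p with
  | zero => simp
  | succ L ih =>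
    rw [Function.iterate_succ_apply, ih]
    push_cast
    rw [add_smul, one_smul]
    abel

/-- The vertices of a straight run: `p + t·e_k`, `0 ≤ t ≤ L`. [folklore] -/
theorem mem_support_run {k : Fin 4} {p w : Site 2} {L : ℕ} :
    w ∈ (run k p L).support ↔ ∃ t : ℕ, t ≤ L ∧ w = p + (t : ℤ) • dir k := by
  induction L generalizing p with
  | zero =>
    show w ∈ (Walk.nil : (zdGraph 2).Walk p p).support ↔ _
    simp
  | succ L ih =>
    show w ∈ (Walk.cons (adj_add_dir p k) (run k (p + dir k) L)).support ↔ _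
    rw [Walk.support_cons, List.mem_cons, ih]
    constructor
    · rintro (rfl | ⟨t, ht, rfl⟩)
      · exact ⟨0, Nat.zero_le _, by simp⟩
      · refine ⟨t + 1, by omega, ?_⟩
        push_cast
        rw [add_smul, one_smul]
        abel
    · rintro ⟨t, ht, rfl⟩
      rcases t with _ | t
      · exact Or.inl (by simp)
      · refine Or.inr ⟨t, by omega, ?_⟩
        push_cast
        rw [add_smul, one_smul]
        abel

/-! ### The four cases of the boundary-tracing successor -/

section SuccCases

variable {x : Site 2} {k : Fin 4}

/-- Case 1 of `succ`: the edge in direction `e_{k+1}` is missing — turn in place. [folklore] -/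
theorem succ_of_not_mem (h1 : s(x, x + dir (k + 1)) ∉ E) : succ E (x, k) = (x, k + 1) := by
  unfold succ; dsimp only; rw [if_pos h1]

/-- Case 2 of `succ`: advance along `e_{k+1}`. [folklore] -/
theorem succ_of_mem_of_not_mem (h1 : ¬ s(x, x + dir (k + 1)) ∉ E)
    (h2 : s(x + dir (k + 1), x + dir (k + 1) + dir k) ∉ E) :
    succ E (x, k) = (x + dir (k + 1), k) := by
  unfold succ; dsimp only; rw [if_neg h1, if_pos h2]

/-- Case 3 of `succ`: advance along `e_{k+1}` then `e_k` (concave corner). [folklore] -/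
theorem succ_of_mem_of_mem_of_not_mem (h1 : ¬ s(x, x + dir (k + 1)) ∉ E)
    (h2 : ¬ s(x + dir (k + 1), x + dir (k + 1) + dir k) ∉ E)
    (h3 : s(x + dir (k + 1) + dir k, x + dir (k + 1) + dir k + dir (k - 1)) ∉ E) :
    succ E (x, k) = (x + dir (k + 1) + dir k, k - 1) := by
  unfold succ; dsimp only; rw [if_neg h1, if_neg h2, if_pos h3]

/-- Case 4 of `succ`: the three other sides of the square on the missing edge are present — the
successor is the reversed dart. [folklore] -/
theorem succ_of_mem_of_mem_of_mem (h1 : ¬ s(x, x + dir (k + 1)) ∉ E)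
    (h2 : ¬ s(x + dir (k + 1), x + dir (k + 1) + dir k) ∉ E)
    (h3 : ¬ s(x + dir (k + 1) + dir k, x + dir (k + 1) + dir k + dir (k - 1)) ∉ E) :
    succ E (x, k) = (x + dir k, k + 2) := by
  unfold succ; dsimp only; rw [if_neg h1, if_neg h2, if_neg h3]
  have e1 : x + dir (k + 1) + dir k + dir (k - 1) = x + dir k := by
    calc x + dir (k + 1) + dir k + dir (k - 1) = x + dir k + (dir (k + 1) + dir (k - 1)) := by abel
      _ = x + dir k := by rw [dir_add_one_add_dir_sub_one, add_zero]
  have e2 : k - 2 = k + 2 := by fin_cases k <;> rfl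
  rw [e1, e2]

end SuccCases

/-! ### The offset boundary connector -/

/-- **The offset-`o` point of a dart** `d = (x, k)` in the eightfold refined lattice: `8x + o·e_k`, a
point of the missing edge `x, x + e_k` at distance `o/8` from `x` (`0 < o < 4`). [folklore] -/
def opt (o : ℕ) (d : Site 2 × Fin 4) : Site 2 := (8 : ℤ) • d.1 + (o : ℤ) • dir d.2

/-- **The offset-`o` connector of the dart `d`**: the lattice walk (in the eightfold refined lattice)
from `opt o d` to `opt o (succ E d)` running at distance `o/8` outside the boundary arrows walked by
the trace from `d` to `succ E d` — round the corner of the exterior square at `x` (case 1), straight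
along the edge `x, y` (case 2), along `x, y` and `y, y'` round the concave corner (case 3), or round
three sides of the exterior square back to the reversed dart (case 4). [folklore] -/
def oconn (E : Finset (Sym2 (Site 2))) (o : ℕ) (ho : 2 * o ≤ 8) (d : Site 2 × Fin 4) :
    (zdGraph 2).Walk (opt o d) (opt o (succ E d)) :=
  if h1 : s(d.1, d.1 + dir (d.2 + 1)) ∉ E then
    ((run (d.2 + 1) (opt o d) o).append (run (d.2 + 2) _ o)).copy rfl (by
      obtain ⟨x, k⟩ := d
      rw [succ_of_not_mem h1, iterate_add_dir, iterate_add_dir]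
      simp only [opt, dir_add_two, smul_neg]
      abel)
  else if h2 : s(d.1 + dir (d.2 + 1), d.1 + dir (d.2 + 1) + dir d.2) ∉ E then
    (run (d.2 + 1) (opt o d) 8).copy rfl (by
      obtain ⟨x, k⟩ := d
      rw [succ_of_mem_of_not_mem h1 h2, iterate_add_dir]
      simp only [opt, smul_add]
      push_cast
      abel)
  else if h3 : s(d.1 + dir (d.2 + 1) + dir d.2, d.1 + dir (d.2 + 1) + dir d.2 + dir (d.2 - 1)) ∉ E then
    ((run (d.2 + 1) (opt o d) (8 - o)).append (run d.2 _ (8 - o))).copy rfl (by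
      obtain ⟨x, k⟩ := d
      rw [succ_of_mem_of_mem_of_not_mem h1 h2 h3, iterate_add_dir, iterate_add_dir]
      have ho' : o ≤ 8 := by omega
      simp only [opt, smul_add, dir_sub_one, smul_neg]
      push_cast [ho']
      simp only [sub_smul]
      abel)
  else
    (((run (d.2 + 1) (opt o d) (8 - o)).append (run d.2 _ (8 - 2 * o))).append
        (run (d.2 + 3) _ (8 - o))).copy rfl (by
      obtain ⟨x, k⟩ := d
      rw [succ_of_mem_of_mem_of_mem h1 h2 h3, iterate_add_dir, iterate_add_dir, iterate_add_dir]
      have ho' : o ≤ 8 := by omega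
      simp only [opt, smul_add, dir_add_three, dir_add_two, smul_neg]
      push_cast [ho', ho]
      simp only [sub_smul, mul_smul]
      abel)

/-- **The offset-`o` boundary connector along `N` steps of the trace** from the dart `d`: the
concatenation of the connectors of `d, succ d, …, succ^{N-1} d`. For a rectangle `IsRect E d₀ n` and
`N = n 0 + n 1 + n 2 + n 3` this is a closed lattice walk, the offset boundary loop of the domain.
[folklore] -/
def oloop (E : Finset (Sym2 (Site 2))) (o : ℕ) (ho : 2 * o ≤ 8) :
    (d : Site 2 × Fin 4) → (N : ℕ) → (zdGraph 2).Walk (opt o d) (opt o ((succ E)^[N] d))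
  | _, 0 => Walk.nil
  | d, N + 1 => (oconn E o ho d).append (oloop E o ho (succ E d) N)

/-- Winding of a copied walk. [folklore] -/
theorem walkWinding_copy' {G : SimpleGraph (Site 2)} {a b a' b' : Site 2} (p : G.Walk a b)
    (ha : a = a') (hb : b = b') (u : Site 2) : walkWinding (p.copy ha hb) u = walkWinding p u := by
  subst ha hb; rfl

/-- The winding of the offset boundary connector is the sum of the windings of its pieces.
[folklore] -/
theorem walkWinding_oloop (o : ℕ) (ho : 2 * o ≤ 8) (d : Site 2 × Fin 4) (N : ℕ) (u : Site 2) :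
    walkWinding (oloop E o ho d N) u =
      ∑ i ∈ Finset.range N, walkWinding (oconn E o ho ((succ E)^[i] d)) u := by
  induction N generalizing d with
  | zero => rfl
  | succ N ih =>
    show walkWinding ((oconn E o ho d).append (oloop E o ho (succ E d) N)) u = _
    rw [walkWinding_append, ih, Finset.sum_range_succ']
    simp only [Function.iterate_succ_apply, Function.iterate_zero, id_eq]
    ring


/-! ### Coordinates of the four directions -/

/-- Coordinates of `e₀`. [folklore] -/
@[simp] theorem dir_zero_apply_zero : dir 0 0 = 1 := by simp [dir]
/-- Coordinates of `e₀`. [folklore] -/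
@[simp] theorem dir_zero_apply_one : dir 0 1 = 0 := by simp [dir]
/-- Coordinates of `e₁`. [folklore] -/
@[simp] theorem dir_one_apply_zero : dir 1 0 = 0 := by simp [dir]
/-- Coordinates of `e₁`. [folklore] -/
@[simp] theorem dir_one_apply_one : dir 1 1 = 1 := by simp [dir]
/-- Coordinates of `-e₀`. [folklore] -/
@[simp] theorem dir_two_apply_zero : dir 2 0 = -1 := by simp [dir]
/-- Coordinates of `-e₀`. [folklore] -/
@[simp] theorem dir_two_apply_one : dir 2 1 = 0 := by simp [dir]
/-- Coordinates of `-e₁`. [folklore] -/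
@[simp] theorem dir_three_apply_zero : dir 3 0 = 0 := by simp [dir]
/-- Coordinates of `-e₁`. [folklore] -/
@[simp] theorem dir_three_apply_one : dir 3 1 = -1 := by simp [dir]

/-- Winding of a run to the right: `0`. [folklore] -/
theorem walkWinding_run_zero (p : Site 2) (L : ℕ) (u : Site 2) : walkWinding (run 0 p L) u = 0 := by
  induction L generalizing p with
  | zero => rfl
  | succ L ih =>
    show walkWinding (Walk.cons (adj_add_dir p 0) (run 0 (p + dir 0) L)) u = 0
    rw [walkWinding_cons, ih, stepWinding_right (by simp)]
    simp

/-- Winding of a run to the left: `0`. [folklore] -/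
theorem walkWinding_run_two (p : Site 2) (L : ℕ) (u : Site 2) : walkWinding (run 2 p L) u = 0 := by
  induction L generalizing p with
  | zero => rfl
  | succ L ih =>
    show walkWinding (Walk.cons (adj_add_dir p 2) (run 2 (p + dir 2) L)) u = 0
    rw [walkWinding_cons, ih, stepWinding_left (by simp)]
    simp

/-- Winding of an upward run of `L` steps from `p`: `+1` around the base points strictly to its left
at the levels it passes, `0` elsewhere. [folklore] -/
theorem walkWinding_run_one (p : Site 2) (L : ℕ) (u : Site 2) :
    walkWinding (run 1 p L) u = if u 0 + 1 ≤ p 0 ∧ p 1 ≤ u 1 ∧ u 1 < p 1 + L then 1 else 0 := by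
  induction L generalizing p with
  | zero =>
    show walkWinding (Walk.nil : (zdGraph 2).Walk p p) u = _
    rw [walkWinding_nil]
    split_ifs <;> omega
  | succ L ih =>
    show walkWinding (Walk.cons (adj_add_dir p 1) (run 1 (p + dir 1) L)) u = _
    rw [walkWinding_cons, ih, stepWinding_up (y := p + dir 1) (by simp) (by simp)]
    simp only [Pi.add_apply, dir_one_apply_zero, add_zero, dir_one_apply_one, Nat.cast_succ]
    split_ifs <;> omega

/-- Winding of a downward run of `L` steps from `p`: `-1` around the base points strictly to its left
at the levels it passes, `0` elsewhere. [folklore] -/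
theorem walkWinding_run_three (p : Site 2) (L : ℕ) (u : Site 2) :
    walkWinding (run 3 p L) u = -(if u 0 + 1 ≤ p 0 ∧ p 1 - L ≤ u 1 ∧ u 1 + 1 ≤ p 1 then 1 else 0) := by
  induction L generalizing p with
  | zero =>
    show walkWinding (Walk.nil : (zdGraph 2).Walk p p) u = _
    rw [walkWinding_nil]
    split_ifs <;> omega
  | succ L ih =>
    show walkWinding (Walk.cons (adj_add_dir p 3) (run 3 (p + dir 3) L)) u = _
    rw [walkWinding_cons, ih, stepWinding_down (y := p + dir 3) (by simp) (by simp)]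
    simp only [Pi.add_apply, dir_three_apply_zero, add_zero, dir_three_apply_one, Nat.cast_succ]
    split_ifs <;> omega

/-- The four elements of `Fin 4`. [folklore] -/
private theorem fin_four_eq (k : Fin 4) : k = 0 ∨ k = 1 ∨ k = 2 ∨ k = 3 := by
  fin_cases k <;> simp

/-- **Winding of one connector piece around a coarse lattice point.** Around the base point `8z`
(i.e. the point `8z + (½, ½)` of the refined lattice, just up-right of the vertex `z`), the
offset connector of the dart `d` winds `+1` if `d` is an east dart on the row of `z` at or to the
right of `z` (its first step goes up through the level of `8z`), `-1` if `succ E d` is a west dart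
on the row of `z` strictly to the right of `z` (its last step comes down through that level), and
these are the only vertical steps of the piece between the levels `8 z₁` and `8 z₁ + 1`. [folklore] -/
theorem walkWinding_oconn {o : ℕ} (ho0 : 0 < o) (ho : 2 * o ≤ 8) (d : Site 2 × Fin 4) (z : Site 2) :
    walkWinding (oconn E o ho d) ((8 : ℤ) • z) =
      (if d.2 = 0 ∧ d.1 1 = z 1 ∧ z 0 ≤ d.1 0 then 1 else 0) -
        (if (succ E d).2 = 2 ∧ (succ E d).1 1 = z 1 ∧ z 0 + 1 ≤ (succ E d).1 0 then 1 else 0) := by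
  obtain ⟨x, k⟩ := d
  unfold oconn
  dsimp only
  by_cases h1 : s(x, x + dir (k + 1)) ∉ E
  · rw [dif_pos h1, walkWinding_copy', walkWinding_append, succ_of_not_mem h1]
    rcases fin_four_eq k with rfl | rfl | rfl | rfl <;>
      simp only [Fin.reduceAdd, walkWinding_run_zero, walkWinding_run_one,
        walkWinding_run_two, walkWinding_run_three] <;>
      simp [iterate_add_dir, opt] <;>
      (try split_ifs) <;> omega
  · rw [dif_neg h1]
    by_cases h2 : s(x + dir (k + 1), x + dir (k + 1) + dir k) ∉ E
    · rw [dif_pos h2, walkWinding_copy', succ_of_mem_of_not_mem h1 h2]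
      rcases fin_four_eq k with rfl | rfl | rfl | rfl <;>
        simp only [Fin.reduceAdd, walkWinding_run_zero, walkWinding_run_one,
          walkWinding_run_two, walkWinding_run_three] <;>
        simp [opt] <;>
        (try split_ifs) <;> omega
    · rw [dif_neg h2]
      by_cases h3 : s(x + dir (k + 1) + dir k, x + dir (k + 1) + dir k + dir (k - 1)) ∉ E
      · rw [dif_pos h3, walkWinding_copy', walkWinding_append, succ_of_mem_of_mem_of_not_mem h1 h2 h3]
        rcases fin_four_eq k with rfl | rfl | rfl | rfl <;>
          simp only [Fin.reduceAdd, Fin.reduceSub, walkWinding_run_zero, walkWinding_run_one,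
            walkWinding_run_two, walkWinding_run_three] <;>
          simp [iterate_add_dir, opt] <;>
          (try split_ifs) <;> omega
      · rw [dif_neg h3, walkWinding_copy', walkWinding_append, walkWinding_append,
          succ_of_mem_of_mem_of_mem h1 h2 h3]
        rcases fin_four_eq k with rfl | rfl | rfl | rfl <;>
          simp only [Fin.reduceAdd, walkWinding_run_zero, walkWinding_run_one,
            walkWinding_run_two, walkWinding_run_three] <;>
          simp [iterate_add_dir, opt] <;>
          (try split_ifs) <;> omega


/-! ### The boundary loop winds once around every vertex of the domain -/

section WindingOne

variable {d₀ : Site 2 × Fin 4} {n : Fin 4 → ℕ}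

/-- **Counting darts of a given direction along one period of the boundary cycle**: by the
traversal bijection of `IsRect` (`injOn`, `cover`), the positions `i < N` whose dart has direction
`k₀` and base vertex satisfying `Q` are in bijection with the vertices `v` of the domain satisfying
`Q` whose edge in direction `e_{k₀}` is missing. [folklore] -/
theorem IsRect.sum_ite_iterate_eq_card (h : IsRect E d₀ n) (k₀ : Fin 4) (Q : Site 2 → Prop)
    [DecidablePred Q] :
    ∑ i ∈ Finset.range (n 0 + n 1 + n 2 + n 3),
        (if ((succ E)^[i] d₀).2 = k₀ ∧ Q ((succ E)^[i] d₀).1 then (1 : ℤ) else 0) =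
      (((verts E).filter fun v ↦ Q v ∧ s(v, v + dir k₀) ∉ E).card : ℤ) := by
  classical
  rw [← Finset.natCast_card_filter]
  congr 1
  refine Finset.card_bij (fun i _ ↦ ((succ E)^[i] d₀).1) ?_ ?_ ?_
  · intro i hi
    simp only [Finset.mem_filter, Finset.mem_range] at hi
    obtain ⟨-, hk, hQ⟩ := hi
    have hd := h.isExtDart.iterate i
    refine Finset.mem_filter.2 ⟨hd.1, hQ, ?_⟩
    have := hd.2
    rwa [hk] at this
  · intro i hi j hj hij
    simp only [Finset.mem_filter, Finset.mem_range] at hi hj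
    refine h.injOn i j hi.1 hj.1 (Prod.ext hij ?_)
    rw [hi.2.1, hj.2.1]
  · intro v hv
    simp only [Finset.mem_filter] at hv
    obtain ⟨hv, hQ, hvk⟩ := hv
    obtain ⟨i, hi, hiv⟩ := h.cover (v, k₀) ⟨hv, hvk⟩
    refine ⟨i, ?_, by rw [hiv]⟩
    simp only [Finset.mem_filter, Finset.mem_range]
    exact ⟨hi, by rw [hiv], by rw [hiv]; exact hQ⟩

/-- **Row scan**: on the row of a vertex `z` of the domain, at or to the right of `z`, the vertices
with a missing east edge outnumber by exactly one the vertices strictly to the right of `z` with a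
missing west edge (reading the row from `z` rightwards, missing east and west edges at vertices of
the domain alternate, starting and ending with a missing east edge, the domain being finite).
[folklore] -/
theorem card_filter_east_eq_card_filter_west_add_one {z : Site 2} (hz : z ∈ verts E) :
    ((verts E).filter fun v ↦ (v 1 = z 1 ∧ z 0 ≤ v 0) ∧ s(v, v + dir 0) ∉ E).card =
      ((verts E).filter fun v ↦ (v 1 = z 1 ∧ z 0 + 1 ≤ v 0) ∧ s(v, v + dir 2) ∉ E).card + 1 := by
  classical
  set Row := (verts E).filter fun v ↦ v 1 = z 1 ∧ z 0 ≤ v 0 with hRow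
  set Row' := (verts E).filter fun v ↦ v 1 = z 1 ∧ z 0 + 1 ≤ v 0 with hRow'
  have hzRow : z ∈ Row := Finset.mem_filter.2 ⟨hz, rfl, le_rfl⟩
  -- `Row' = Row \ {z}`
  have hRow'eq : Row' = Row.erase z := by
    ext v
    simp only [hRow, hRow', Finset.mem_filter, Finset.mem_erase]
    constructor
    · rintro ⟨hv, h1, h0⟩
      refine ⟨?_, hv, h1, by omega⟩
      rintro rfl
      omega
    · rintro ⟨hne, hv, h1, h0⟩
      refine ⟨hv, h1, ?_⟩
      rcases (show z 0 < v 0 ∨ z 0 = v 0 by omega) with hlt | heq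
      · omega
      · exact absurd (Site.eq_iff_two.2 ⟨heq.symm, h1⟩) hne
  have hcardRow' : Row'.card + 1 = Row.card := by
    rw [hRow'eq, Finset.card_erase_of_mem hzRow]
    have : 0 < Row.card := Finset.card_pos.2 ⟨z, hzRow⟩
    omega
  -- the two filtered sets, as complements inside `Row`, `Row'`
  have hE : ((verts E).filter fun v ↦ (v 1 = z 1 ∧ z 0 ≤ v 0) ∧ s(v, v + dir 0) ∉ E) =
      Row.filter fun v ↦ s(v, v + dir 0) ∉ E := by
    rw [hRow, Finset.filter_filter]
  have hW : ((verts E).filter fun v ↦ (v 1 = z 1 ∧ z 0 + 1 ≤ v 0) ∧ s(v, v + dir 2) ∉ E) =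
      Row'.filter fun v ↦ s(v, v + dir 2) ∉ E := by
    rw [hRow', Finset.filter_filter]
  have hsplitE := Finset.card_filter_add_card_filter_not (s := Row) (fun v ↦ s(v, v + dir 0) ∈ E)
  have hsplitW := Finset.card_filter_add_card_filter_not (s := Row') (fun v ↦ s(v, v + dir 2) ∈ E)
  -- the present east edges from `Row` and the present west edges from `Row'` are the same edges
  have hbij : (Row'.filter fun v ↦ s(v, v + dir 2) ∈ E).card =
      (Row.filter fun v ↦ s(v, v + dir 0) ∈ E).card := by
    refine Finset.card_bij (fun v _ ↦ v + dir 2) ?_ ?_ ?_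
    · intro v hv
      simp only [hRow', Finset.mem_filter] at hv
      obtain ⟨⟨-, h1, h0⟩, he⟩ := hv
      simp only [hRow, Finset.mem_filter]
      refine ⟨⟨mem_verts_of_mem he, ?_, ?_⟩, ?_⟩
      · simpa using h1
      · simp; omega
      · have : v + dir 2 + dir 0 = v := by
          rw [add_assoc, show dir 2 + dir 0 = 0 from (dir_add_dir_eq_zero_iff 2 0).2 rfl, add_zero]
        rw [this, Sym2.eq_swap]
        exact he
    · intro v _ w _ hvw
      exact add_right_cancel hvw
    · intro w hw
      simp only [hRow, Finset.mem_filter] at hw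
      obtain ⟨⟨-, h1, h0⟩, he⟩ := hw
      refine ⟨w + dir 0, ?_, ?_⟩
      · simp only [hRow', Finset.mem_filter]
        refine ⟨⟨mem_verts_of_mem he, ?_, ?_⟩, ?_⟩
        · simpa using h1
        · simp; omega
        · have : w + dir 0 + dir 2 = w := by
            rw [add_assoc, show dir 0 + dir 2 = 0 from (dir_add_dir_eq_zero_iff 0 2).2 rfl, add_zero]
          rw [this, Sym2.eq_swap]
          exact he
      · rw [add_assoc, show dir 0 + dir 2 = 0 from (dir_add_dir_eq_zero_iff 0 2).2 rfl, add_zero]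
  rw [hE, hW]
  omega

/-- **The offset boundary loop winds exactly once around every vertex of the domain**
(CDH16 §2.1: the boundary cycle of a simply connected discrete domain, here in the presentation
`IsRect E d₀ n`, goes once counterclockwise round `Ω`): for `z` a vertex of the domain, the winding
number of the offset-`o` boundary loop (one period, `N = n 0 + n 1 + n 2 + n 3` pieces) around the
point `8z + (½, ½)` of the refined lattice is `1`. Proof: by `walkWinding_oconn` the winding is the
number of east darts minus the number of west darts on the row of `z` to the right of `z`, counted
along one period of the boundary cycle, i.e. (traversal bijection) over the external darts of the
domain; the row scan gives `+1`. In particular the trace runs counterclockwise, with the domain on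
its left. [cite: ChelkakDuminilCopinHongler2016, §2.1] -/
theorem IsRect.walkWinding_oloop_eq_one (h : IsRect E d₀ n) {o : ℕ} (ho0 : 0 < o) (ho : 2 * o ≤ 8)
    {z : Site 2} (hz : z ∈ verts E) :
    walkWinding (oloop E o ho d₀ (n 0 + n 1 + n 2 + n 3)) ((8 : ℤ) • z) = 1 := by
  classical
  set N := n 0 + n 1 + n 2 + n 3 with hN
  rw [DiscreteRect.walkWinding_oloop, Finset.sum_congr rfl fun i _ ↦ walkWinding_oconn ho0 ho _ z,
    Finset.sum_sub_distrib]
  -- reindex the second sum along the periodic cycle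
  have hper : ∀ f : Site 2 × Fin 4 → ℤ,
      ∑ i ∈ Finset.range N, f (succ E ((succ E)^[i] d₀)) = ∑ i ∈ Finset.range N, f ((succ E)^[i] d₀) := by
    intro f
    have h1 : ∑ i ∈ Finset.range (N + 1), f ((succ E)^[i] d₀) =
        ∑ i ∈ Finset.range N, f (succ E ((succ E)^[i] d₀)) + f d₀ := by
      rw [Finset.sum_range_succ']
      simp only [Function.iterate_succ_apply', Function.iterate_zero, id_eq]
    have h2 : ∑ i ∈ Finset.range (N + 1), f ((succ E)^[i] d₀) =
        ∑ i ∈ Finset.range N, f ((succ E)^[i] d₀) + f d₀ := by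
      rw [Finset.sum_range_succ, h.periodic]
    linarith
  rw [hper (fun d ↦ if d.2 = 2 ∧ d.1 1 = z 1 ∧ z 0 + 1 ≤ d.1 0 then (1 : ℤ) else 0)]
  rw [h.sum_ite_iterate_eq_card 0 (fun v ↦ v 1 = z 1 ∧ z 0 ≤ v 0),
    h.sum_ite_iterate_eq_card 2 (fun v ↦ v 1 = z 1 ∧ z 0 + 1 ≤ v 0),
    card_filter_east_eq_card_filter_west_add_one hz]
  push_cast
  ring

end WindingOne

end DiscreteRect

end Literature.Probability.LatticeModels

end
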